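import Summits.HodgeConjecture.FermatCycles.ConditionQFourfold
import HarnessLib

/-!
# Shioda's condition `(Q⁴ₘ)` by kernel exhaustion with certificates — soundness of the normalised search

HONEST FRAMING: explicit algebraic cycles for specific Hodge classes on Fermat/Delsarte varieties;
residual open instances listed; no claim on general Hodge.

Topic path `Summits/HodgeConjecture/FermatCycles/` of cell `pub-hfermat` (new work, not literature). Sequel of
`ConditionQFourfold.lean` (Booleans `genB`/`certB`/`lookupB`/`qtestB`, searches `checkQU`/`checkQN`, sorted-form soundness
`qU_of_chunks`/`qN_of_chunks`, unit invariance `stably_map_unit`). Here the invariant form: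

* **`conditionQ_four_of_normalized`**: if chunks of first free representatives covering `[1, N)` pass the case-U search `checkQU N T`
  and chunks covering `[1, N)` pass the case-N search `checkQN N T`, then Shioda's stable-generation condition
  `Shioda1979.ConditionQ N 4` = `(Q⁴_N)` holds: every Hodge sextuple over `ℤ/N` (every element of `M_N` of length `3`, i.e. every
  Hodge character of the Fermat fourfold `X⁴_N` up to permutation) is `ξ₁ − ξ₂` with `ξ₁, ξ₂ ∈ M'_N`. (A Hodge sextuple with a unit
  entry `a` is `a · s'` with `1 ∈ s'`: sort the other five representatives of `s'`, use case U and transport back by `a`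
  (`stably_map_unit`); otherwise all six entries are non-units: sort and use case N. Same skeleton as
  `ShiodaConditionFourfold.shiodaConditionUpTo_four_of_normalized`.)
* **`forall_of_closed_cancellative`**: with Shioda's Claim (tree: `Shioda1979.forall_of_conditionQ`, the printed proof of
  "(Qⁿₘ) ⇒ Theorem III", Lemmas 2–3 p. 183) — under the same searches every family of multisets over `ℤ/N` closed under the
  inductive structure (`IsShiodaClosed`) and under Lemma 3's cancellation (`Shioda1979.IsCancellative`) contains every non-empty Hodge
  multiset of cardinality `≤ 6`.

No definition, no named fact. Nothing here asserts the Hodge conjecture for any `Xⁿₘ`: the geometric inputs of Shioda's Claim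
(Theorem II, Lefschetz (1,1), Lemma 3 on the real carriers) are hypotheses of `forall_of_closed_cancellative` in the printed shape.

References: [Shioda1979HodgeFermat] T. Shioda, Math. Ann. 245 (1979), §4 pp. 183–184; [Shioda1979PJA] T. Shioda, Proc. Japan Acad.
55A (1979) §1.
-/

namespace Summit.HodgeConjecture.FermatCycles.ConditionQFourfold

open Multiset
open Literature.AlgebraicGeometry.HodgeTheory Literature.AlgebraicGeometry.HodgeTheory.FermatCharacter
open Literature.AlgebraicGeometry.Shioda1982 Literature.AlgebraicGeometry.Shioda1979
open Summit.HodgeConjecture.FermatCycles.ShiodaConditionFourfold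

/-- **Soundness of the normalised `(Q)`-search.** Case-U chunks covering `[1, N)` passing `checkQU N T` and case-N chunks covering
`[1, N)` passing `checkQN N T` give `(Q⁴_N)` = `Shioda1979.ConditionQ N 4`. [cite: Shioda1979HodgeFermat, §4 condition (Qⁿₘ), p. 183] -/
theorem conditionQ_four_of_normalized (N : ℕ) [NeZero N] [Fact (1 < N)] (T : List (List ℕ × List (List ℕ) × List (List ℕ)))
    (chunksU : List (ℕ × ℕ)) (hcovU : ∀ b, 0 < b → b < N → ∃ p ∈ chunksU, p.1 ≤ b ∧ b < p.1 + p.2)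
    (hU : ∀ p ∈ chunksU, checkQU N T p.1 p.2 = true)
    (chunksN : List (ℕ × ℕ)) (hcovN : ∀ a, 0 < a → a < N → ∃ p ∈ chunksN, p.1 ≤ a ∧ a < p.1 + p.2)
    (hN : ∀ p ∈ chunksN, checkQN N T p.1 p.2 = true) : ConditionQ N 4 := by
  intro s hH h6 h6'
  have hcard : card s = 6 := by omega
  by_cases hex : ∃ a ∈ s, IsUnit a
  · -- case U: scale a unit entry to 1
    obtain ⟨a, ha, hua⟩ := hex
    set u : (ZMod N)ˣ := hua.unit with hu
    have hua' : (u : ZMod N) = a := hua.unit_spec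
    set s' : Multiset (ZMod N) := s.map fun x ↦ ((u⁻¹ : (ZMod N)ˣ) : ZMod N) * x with hs'
    have hH' : IsHodgeMultiset s' := isHodgeMultiset_map_unit u⁻¹ hH
    have hcard' : card s' = 6 := by rw [hs', Multiset.card_map, hcard]
    have h1 : (1 : ZMod N) ∈ s' := by
      rw [hs', Multiset.mem_map]
      exact ⟨a, ha, by rw [← hua', Units.inv_mul]⟩
    obtain ⟨r, hr⟩ := Multiset.exists_cons_of_mem h1
    have hcr : card r = 5 := by
      have := congrArg card hr
      rw [hcard', Multiset.card_cons] at this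
      omega
    obtain ⟨v, hvs, hsorted⟩ : ∃ v : List ℕ, (v : Multiset ℕ) = r.map ZMod.val ∧ v.Pairwise (· ≤ ·) :=
      ⟨(r.map ZMod.val).sort, Multiset.sort_eq _ _, Multiset.pairwise_sort _ _⟩
    have hlen : v.length = 5 := by
      have := congrArg Multiset.card hvs
      simpa [hcr] using this
    obtain ⟨b', v2, rfl⟩ := List.exists_of_length_succ v hlen
    obtain ⟨c', v3, rfl⟩ := List.exists_of_length_succ v2 (by simpa using hlen)
    obtain ⟨d', v4, rfl⟩ := List.exists_of_length_succ v3 (by simpa using hlen)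
    obtain ⟨e', v5, rfl⟩ := List.exists_of_length_succ v4 (by simpa using hlen)
    obtain ⟨f', v6, rfl⟩ := List.exists_of_length_succ v5 (by simpa using hlen)
    have hv6 : v6 = [] := by simpa using hlen
    subst hv6
    have hlt : ∀ x ∈ ([b', c', d', e', f'] : List ℕ), x < N := by
      intro x hx
      have hx' : x ∈ r.map ZMod.val := by rw [← hvs]; exact Multiset.mem_coe.mpr hx
      obtain ⟨y, -, rfl⟩ := Multiset.mem_map.mp hx'
      exact ZMod.val_lt y
    have hb' : b' < N := hlt b' (by simp)
    have hc' : c' < N := hlt c' (by simp)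
    have hd' : d' < N := hlt d' (by simp)
    have he' : e' < N := hlt e' (by simp)
    have hf' : f' < N := hlt f' (by simp)
    have hr' : r = {(b' : ZMod N), (c' : ZMod N), (d' : ZMod N), (e' : ZMod N), (f' : ZMod N)} := by
      have hr1 : r = (r.map ZMod.val).map (fun n : ℕ ↦ (n : ZMod N)) := by
        rw [Multiset.map_map]
        conv_lhs => rw [← Multiset.map_id r]
        refine Multiset.map_congr rfl fun x _ ↦ ?_
        simp
      rw [hr1, ← hvs]
      rfl
    have hsum : (f' : ZMod N) = -(1 + (b' : ZMod N) + (c' : ZMod N) + (d' : ZMod N) + (e' : ZMod N)) := by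
      have h0 := hH'.1.2
      rw [hr, hr'] at h0
      simp only [Multiset.insert_eq_cons, Multiset.sum_cons, Multiset.sum_singleton] at h0
      linear_combination h0
    have hs'eq : s' = {1, (b' : ZMod N), (c' : ZMod N), (d' : ZMod N), (e' : ZMod N),
        -(1 + (b' : ZMod N) + (c' : ZMod N) + (d' : ZMod N) + (e' : ZMod N))} := by
      rw [hr, hr', hsum]; rfl
    rw [hs'eq] at hH'
    simp only [List.pairwise_cons, List.mem_cons, List.not_mem_nil, or_false, forall_eq_or_imp,
      forall_eq] at hsorted
    have hbc : (b' : ZMod N).val ≤ (c' : ZMod N).val := by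
      rw [ZMod.val_natCast_of_lt hb', ZMod.val_natCast_of_lt hc']; omega
    have hcd : (c' : ZMod N).val ≤ (d' : ZMod N).val := by
      rw [ZMod.val_natCast_of_lt hc', ZMod.val_natCast_of_lt hd']; omega
    have hde : (d' : ZMod N).val ≤ (e' : ZMod N).val := by
      rw [ZMod.val_natCast_of_lt hd', ZMod.val_natCast_of_lt he']; omega
    have hef : (e' : ZMod N).val ≤ (-(1 + (b' : ZMod N) + (c' : ZMod N) + (d' : ZMod N) + (e' : ZMod N))).val := by
      rw [← hsum, ZMod.val_natCast_of_lt he', ZMod.val_natCast_of_lt hf']; omega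
    have key := qU_of_chunks N T chunksU hcovU hU _ _ _ _ hbc hcd hde hef hH'
    rw [← hs'eq] at key
    have back := stably_map_unit u key
    rwa [hs', map_unit_map_inv] at back
  · -- case N: no unit entry
    push Not at hex
    obtain ⟨v, hvs, hsorted⟩ : ∃ v : List ℕ, (v : Multiset ℕ) = s.map ZMod.val ∧ v.Pairwise (· ≤ ·) :=
      ⟨(s.map ZMod.val).sort, Multiset.sort_eq _ _, Multiset.pairwise_sort _ _⟩
    have hlen : v.length = 6 := by
      have := congrArg Multiset.card hvs
      simpa [hcard] using this
    obtain ⟨a', v1, rfl⟩ := List.exists_of_length_succ v hlen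
    obtain ⟨b', v2, rfl⟩ := List.exists_of_length_succ v1 (by simpa using hlen)
    obtain ⟨c', v3, rfl⟩ := List.exists_of_length_succ v2 (by simpa using hlen)
    obtain ⟨d', v4, rfl⟩ := List.exists_of_length_succ v3 (by simpa using hlen)
    obtain ⟨e', v5, rfl⟩ := List.exists_of_length_succ v4 (by simpa using hlen)
    obtain ⟨f', v6, rfl⟩ := List.exists_of_length_succ v5 (by simpa using hlen)
    have hv6 : v6 = [] := by simpa using hlen
    subst hv6
    have hlt : ∀ x ∈ ([a', b', c', d', e', f'] : List ℕ), x < N := by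
      intro x hx
      have hx' : x ∈ s.map ZMod.val := by rw [← hvs]; exact Multiset.mem_coe.mpr hx
      obtain ⟨y, -, rfl⟩ := Multiset.mem_map.mp hx'
      exact ZMod.val_lt y
    have ha' : a' < N := hlt a' (by simp)
    have hb' : b' < N := hlt b' (by simp)
    have hc' : c' < N := hlt c' (by simp)
    have hd' : d' < N := hlt d' (by simp)
    have he' : e' < N := hlt e' (by simp)
    have hf' : f' < N := hlt f' (by simp)
    have hs' : s = {(a' : ZMod N), (b' : ZMod N), (c' : ZMod N), (d' : ZMod N), (e' : ZMod N), (f' : ZMod N)} := by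
      have h1 : s = (s.map ZMod.val).map (fun n : ℕ ↦ (n : ZMod N)) := by
        rw [Multiset.map_map]
        conv_lhs => rw [← Multiset.map_id s]
        refine Multiset.map_congr rfl fun x _ ↦ ?_
        simp
      rw [h1, ← hvs]
      rfl
    have hmem : ∀ x ∈ ({(a' : ZMod N), (b' : ZMod N), (c' : ZMod N), (d' : ZMod N), (e' : ZMod N), (f' : ZMod N)} :
        Multiset (ZMod N)), ¬ IsUnit x := by
      intro x hx; rw [← hs'] at hx; exact hex x hx
    have hsum : (f' : ZMod N) = -((a' : ZMod N) + (b' : ZMod N) + (c' : ZMod N) + (d' : ZMod N) + (e' : ZMod N)) := by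
      have h0 := hH.1.2
      rw [hs'] at h0
      simp only [Multiset.insert_eq_cons, Multiset.sum_cons, Multiset.sum_singleton] at h0
      linear_combination h0
    have hua : ¬ IsUnit (a' : ZMod N) := hmem _ (by simp)
    have hub : ¬ IsUnit (b' : ZMod N) := hmem _ (by simp)
    have huc : ¬ IsUnit (c' : ZMod N) := hmem _ (by simp)
    have hud : ¬ IsUnit (d' : ZMod N) := hmem _ (by simp)
    have hue : ¬ IsUnit (e' : ZMod N) := hmem _ (by simp)
    rw [hs', hsum] at hH ⊢
    simp only [List.pairwise_cons, List.mem_cons, List.not_mem_nil, or_false, forall_eq_or_imp,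
      forall_eq] at hsorted
    have hab : (a' : ZMod N).val ≤ (b' : ZMod N).val := by
      rw [ZMod.val_natCast_of_lt ha', ZMod.val_natCast_of_lt hb']; omega
    have hbc : (b' : ZMod N).val ≤ (c' : ZMod N).val := by
      rw [ZMod.val_natCast_of_lt hb', ZMod.val_natCast_of_lt hc']; omega
    have hcd : (c' : ZMod N).val ≤ (d' : ZMod N).val := by
      rw [ZMod.val_natCast_of_lt hc', ZMod.val_natCast_of_lt hd']; omega
    have hde : (d' : ZMod N).val ≤ (e' : ZMod N).val := by
      rw [ZMod.val_natCast_of_lt hd', ZMod.val_natCast_of_lt he']; omega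
    have hef : (e' : ZMod N).val ≤ (-((a' : ZMod N) + (b' : ZMod N) + (c' : ZMod N) + (d' : ZMod N) + (e' : ZMod N))).val := by
      rw [← hsum, ZMod.val_natCast_of_lt he', ZMod.val_natCast_of_lt hf']; omega
    exact qN_of_chunks N T chunksN hcovN hN _ _ _ _ _ hab hbc hcd hde hef hua hub huc hud hue hH

/-- **Shioda's Claim applied**: under the same searches, every family of multisets over `ℤ/N` closed under the inductive structure
of Fermat varieties and under Lemma 3's cancellation contains every non-empty Hodge multiset with at most `6` elements — the
arithmetic form of "(Q⁴_N) ⇒ the Hodge conjecture for `X⁴_N`" (the geometric inputs being the closure hypotheses, as printed).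
[cite: Shioda1979HodgeFermat, §4 Claim, Lemmas 2–3, p. 183] -/
theorem forall_of_closed_cancellative (N : ℕ) [NeZero N] [Fact (1 < N)] (T : List (List ℕ × List (List ℕ) × List (List ℕ)))
    (chunksU : List (ℕ × ℕ)) (hcovU : ∀ b, 0 < b → b < N → ∃ p ∈ chunksU, p.1 ≤ b ∧ b < p.1 + p.2)
    (hU : ∀ p ∈ chunksU, checkQU N T p.1 p.2 = true)
    (chunksN : List (ℕ × ℕ)) (hcovN : ∀ a, 0 < a → a < N → ∃ p ∈ chunksN, p.1 ≤ a ∧ a < p.1 + p.2)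
    (hN : ∀ p ∈ chunksN, checkQN N T p.1 p.2 = true)
    {C : Multiset (ZMod N) → Prop} (hC : IsShiodaClosed C) (hL : IsCancellative C) :
    ∀ s : Multiset (ZMod N), s ≠ 0 → IsHodgeMultiset s → card s ≤ 6 → C s :=
  forall_of_conditionQ hC hL (conditionQ_four_of_normalized N T chunksU hcovU hU chunksN hcovN hN)

end Summit.HodgeConjecture.FermatCycles.ConditionQFourfold
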